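import Summits.Ventures.WeilGRH.FlatWindowDetermines
import Mathlib.MeasureTheory.Measure.CharacteristicFunction.Basic
import HarnessLib

/-!
# GRH arm (rh-explicit, venture WeilGRH): the flat windows determine the SYMMETRIZED spectral measure
  `t⁻²dμ + (t⁻²dμ)ˇ` — the characteristic-function step

Cell `rh-explicit`, WEIL TRACK (structure seat weil-3, gen9).  `FlatWindowDetermines.lean` shows that equal
Fejér energies at all windows force equal `M₂` and equal cosine transforms `∫cos(ξt)t⁻²dμ`.  Here the last
step: the finite measure `ν = t⁻²·μ` (`μ.withDensity (ofReal ∘ t⁻²)`) symmetrized, `σ = ν + ν.map(−)`, has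
characteristic function `charFun σ ξ = 2∫cos(ξt)t⁻²dμ`, so by the uniqueness theorem for characteristic
functions of finite measures (`Measure.ext_of_charFun`): **equal flat energies ⟹ equal symmetrized
measures `σ₁ = σ₂`** (`symmetrized_eq_of_fejerEnergy_eq`).  No definitions, no named facts.
-/

set_option autoImplicit false

noncomputable section

open Complex Filter Set MeasureTheory
open scoped Real Topology ComplexConjugate

namespace Summit.Ventures.WeilGRH

/-- The density `t ↦ ofReal(t⁻²)`. -/
private theorem measurable_invSqDensity : Measurable fun t : ℝ ↦ ENNReal.ofReal ((t ^ 2)⁻¹) :=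
  ((measurable_id.pow_const 2).inv).ennreal_ofReal

/-- `t⁻²·μ` is a finite measure when `t⁻² ∈ L¹(μ)`. -/
theorem isFiniteMeasure_withDensity_invSq {μ : Measure ℝ} (hM : Integrable (fun t : ℝ ↦ (t ^ 2)⁻¹) μ) :
    IsFiniteMeasure (μ.withDensity fun t ↦ ENNReal.ofReal ((t ^ 2)⁻¹)) :=
  isFiniteMeasure_withDensity_ofReal hM.2

/-- **The characteristic function of the symmetrized measure `t⁻²μ + (t⁻²μ)ˇ` is twice the cosine
transform**: `charFun σ ξ = 2∫cos(ξt)t⁻²dμ`. -/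
theorem charFun_symmetrized_withDensity {μ : Measure ℝ} (hM : Integrable (fun t : ℝ ↦ (t ^ 2)⁻¹) μ) (ξ : ℝ) :
    charFun ((μ.withDensity fun t ↦ ENNReal.ofReal ((t ^ 2)⁻¹)) +
        (μ.withDensity fun t ↦ ENNReal.ofReal ((t ^ 2)⁻¹)).map Neg.neg) ξ =
      ((2 * ∫ t, Real.cos (ξ * t) / t ^ 2 ∂μ : ℝ) : ℂ) := by
  set ν := μ.withDensity fun t ↦ ENNReal.ofReal ((t ^ 2)⁻¹) with hν
  haveI : IsFiniteMeasure ν := isFiniteMeasure_withDensity_invSq hM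
  -- `charFun (ν + ν.map neg) ξ = charFun ν ξ + charFun ν (−ξ)`
  have hneg : ν.map Neg.neg = ν.map ((-1 : ℝ) * ·) := by
    congr 1; funext x; ring
  have hint : ∀ (ρ : Measure ℝ) [IsFiniteMeasure ρ], Integrable (fun x : ℝ ↦ cexp (ξ * x * I)) ρ := by
    intro ρ _
    refine (integrable_const (1 : ℝ)).mono' (by fun_prop : Continuous fun x : ℝ ↦ cexp (ξ * x * I)).aestronglyMeasurable
      (Eventually.of_forall fun x ↦ ?_)
    rw [show (ξ : ℂ) * x * I = ((ξ * x : ℝ) : ℂ) * I by push_cast; ring, Complex.norm_exp_ofReal_mul_I]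
  haveI : IsFiniteMeasure (ν.map Neg.neg) := Measure.isFiniteMeasure_map ν Neg.neg
  have hadd : charFun (ν + ν.map Neg.neg) ξ = charFun ν ξ + charFun ν (-ξ) := by
    rw [charFun_apply_real, integral_add_measure (hint ν) (hint _), ← charFun_apply_real, ← charFun_apply_real,
      hneg, charFun_map_mul, neg_one_mul]
  rw [hadd, charFun_neg, Complex.add_conj, charFun_apply_real]
  -- `Re ∫ e^{iξx} dν = ∫ cos(ξx) dν = ∫ cos(ξt) t⁻² dμ`
  have hre : (∫ x, cexp (ξ * x * I) ∂ν).re = ∫ x, Real.cos (ξ * x) ∂ν := by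
    rw [← RCLike.re_eq_complex_re, ← integral_re (hint ν)]
    refine integral_congr_ae (Eventually.of_forall fun x ↦ ?_)
    show RCLike.re (cexp (ξ * x * I)) = Real.cos (ξ * x)
    rw [show (ξ : ℂ) * x * I = ((ξ * x : ℝ) : ℂ) * I by push_cast; ring, RCLike.re_eq_complex_re,
      Complex.exp_ofReal_mul_I_re]
  have hdens : ∫ x, Real.cos (ξ * x) ∂ν = ∫ t, Real.cos (ξ * t) / t ^ 2 ∂μ := by
    rw [hν, integral_withDensity_eq_integral_toReal_smul measurable_invSqDensity
      (Eventually.of_forall fun _ ↦ ENNReal.ofReal_lt_top)]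
    refine integral_congr_ae (Eventually.of_forall fun t ↦ ?_)
    show (ENNReal.ofReal ((t ^ 2)⁻¹)).toReal • Real.cos (ξ * t) = Real.cos (ξ * t) / t ^ 2
    rw [ENNReal.toReal_ofReal (by positivity), smul_eq_mul, div_eq_inv_mul]
  rw [hre, hdens]

/-- **THE FLAT WINDOWS DETERMINE THE SYMMETRIZED SPECTRAL MEASURE.**  Two σ-finite measures on `ℝ` with
`t⁻² ∈ L¹` and equal Fejér energies `∫2sin²(at)/t²` at every window `a > 0` have equal symmetrizations of
`t⁻²dμ`: `t⁻²μ₁ + (t⁻²μ₁)ˇ = t⁻²μ₂ + (t⁻²μ₂)ˇ` (uniqueness of characteristic functions of finite measures). -/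
theorem symmetrized_eq_of_fejerEnergy_eq {μ₁ μ₂ : Measure ℝ} [SFinite μ₁] [SFinite μ₂]
    (hM₁ : Integrable (fun t : ℝ ↦ (t ^ 2)⁻¹) μ₁) (hM₂ : Integrable (fun t : ℝ ↦ (t ^ 2)⁻¹) μ₂)
    (h : ∀ a : ℝ, 0 < a →
      ∫ t, 2 * Real.sin (a * t) ^ 2 / t ^ 2 ∂μ₁ = ∫ t, 2 * Real.sin (a * t) ^ 2 / t ^ 2 ∂μ₂) :
    (μ₁.withDensity fun t ↦ ENNReal.ofReal ((t ^ 2)⁻¹)) +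
        (μ₁.withDensity fun t ↦ ENNReal.ofReal ((t ^ 2)⁻¹)).map Neg.neg =
      (μ₂.withDensity fun t ↦ ENNReal.ofReal ((t ^ 2)⁻¹)) +
        (μ₂.withDensity fun t ↦ ENNReal.ofReal ((t ^ 2)⁻¹)).map Neg.neg := by
  haveI := isFiniteMeasure_withDensity_invSq hM₁
  haveI := isFiniteMeasure_withDensity_invSq hM₂
  haveI : IsFiniteMeasure ((μ₁.withDensity fun t ↦ ENNReal.ofReal ((t ^ 2)⁻¹)).map Neg.neg) :=
    Measure.isFiniteMeasure_map _ _
  haveI : IsFiniteMeasure ((μ₂.withDensity fun t ↦ ENNReal.ofReal ((t ^ 2)⁻¹)).map Neg.neg) :=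
    Measure.isFiniteMeasure_map _ _
  obtain ⟨-, hcos⟩ := cosTransform_eq_of_fejerEnergy_eq hM₁ hM₂ h
  refine Measure.ext_of_charFun (funext fun ξ ↦ ?_)
  rw [charFun_symmetrized_withDensity hM₁, charFun_symmetrized_withDensity hM₂, hcos ξ]

end Summit.Ventures.WeilGRH

end
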